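import Summits.CriticalPhenomena.SAWScalingLimit.Theorems.SAWRestrictionRigidityLimitExistsObservablewiseTight
import Summits.CriticalPhenomena.SAWScalingLimit.Theorems.SAWRestrictionRigidityLimitExistsCountable
import HarnessLib

/-!
# `LimitExists` (crux stmt-CriticalPhenomena-1371) — the CAUCHY (two-mesh) form of the crux

Route `SAWRestrictionRigidity` of `CriticalPhenomena/SAWScalingLimit`; line `registered`
(`Cruxes/LimitExists/Lines/birth.lean`), lead c6.

The observable-wise form `limitExists_iff_forall_tendsto_integral` (lead c3, `…LimitExistsObservablewiseTight`)
says the crux is the convergence, along `δ → 0⁺`, of every critical expectation `E_δ[f(γ)]` (`f` a bounded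
continuous observable of the curve class, one Dobrushin domain and one endpoint approximation at a time).  A
real net along the countably generated, non-trivial filter `𝓝[>] 0` converges iff it is Cauchy
(`exists_tendsto_nhdsGT_iff_forall_dist_lt`, completeness of `ℝ`), so the limit VALUE can be removed from the
right-hand side as well:

* **`limitExists_iff_forall_cauchy_integral`** — `LimitExists ↔` for every Dobrushin domain, endpoint
  approximation, bounded continuous observable `f` and `ε > 0` there is `δ₀ > 0` with
  `|E_δ[f(γ)] - E_δ'[f(γ)]| < ε` for all meshes `δ, δ' ∈ (0, δ₀)`.  This is the crux as a pure FINITE-MESH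
  COMPARISON: two critical SAW measures of the same domain at two small meshes, tested against one observable —
  no limit object, no tightness, no chordality, no identification; the shape of statement a coupling between
  the critical SAWs of `Ω_δ` and `Ω_δ'` would deliver.
* **`limitExists_iff_eventualTight_and_countable_cauchy`** — modulo eventual tightness (item
  stmt-CriticalPhenomena-1372) the comparison is needed only for the COUNTABLY many observables of one separating
  family (lead c4's `limitExists_iff_eventualTight_and_countable`).

Remark (why the comparison cannot be restricted to commensurable meshes).  A renormalisation-type coupling
compares `Ω_δ` with its refinement `Ω_{δ/2}` (`δℤ² ⊆ (δ/2)ℤ²`); summable errors along `δ₀ 2^{-k}` give a limit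
`L(δ₀)` along each geometric mesh sequence, but the full filter `δ → 0⁺` also runs through mutually
incommensurable meshes: by the exact dilation identity `(λΩ)_δ = λ • Ω_{δ/λ}` the missing "within-octave"
comparison (`δ' ∈ (δ/2, δ]`) is a statement about the dyadic limits of the DILATED domains `λ⁻¹ • Ω`,
`λ ∈ [1, 2)`, i.e. a domain-continuity input — which is why the two-mesh form above quantifies over all pairs
`δ, δ' < δ₀`.

Everything proved, standard axioms. [folklore]
-/

noncomputable section

open Literature.Probability.RandomPlanarGeometry Literature.Probability.RandomPlanarGeometry.SAW
  Literature.Probability.LatticeModels MeasureTheory Filter Topology Set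
open scoped BoundedContinuousFunction

namespace Summit.CriticalPhenomena.SAWScalingLimit.Theorems.SAWRestrictionRigidityLimitExists

open Summit.CriticalPhenomena.SAWScalingLimit.Theses.SAWRestrictionRigidity (LimitExists EventualTight)

/-- **A net along `δ → 0⁺` with values in a complete (pseudo)metric space converges iff it is Cauchy**, in
the `ε`–`δ₀` form: `∃ L, u → L` along `𝓝[>] 0` iff for every `ε > 0` there is `δ₀ > 0` with
`dist (u δ) (u δ') < ε` whenever `δ, δ' ∈ (0, δ₀)`.  (`𝓝[>] 0` is non-trivial on `ℝ`; Mathlib's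
`cauchy_map_iff_exists_tendsto` and `Metric.cauchy_iff`, with the basis `Ioo 0 δ₀` of `𝓝[>] 0`.) [folklore] -/
theorem exists_tendsto_nhdsGT_iff_forall_dist_lt {E : Type*} [PseudoMetricSpace E] [CompleteSpace E]
    (u : ℝ → E) :
    (∃ L : E, Tendsto u (𝓝[>] (0 : ℝ)) (𝓝 L)) ↔
      ∀ ε : ℝ, 0 < ε → ∃ δ₀ : ℝ, 0 < δ₀ ∧ ∀ δ δ' : ℝ, 0 < δ → δ < δ₀ → 0 < δ' → δ' < δ₀ →
        dist (u δ) (u δ') < ε := by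
  constructor
  · rintro ⟨L, hL⟩ ε hε
    have hev : ∀ᶠ x in 𝓝[>] (0 : ℝ), dist (u x) L < ε / 2 :=
      Metric.tendsto_nhds.1 hL _ (half_pos hε)
    obtain ⟨δ₀, hδ₀, hsub⟩ := mem_nhdsGT_iff_exists_Ioo_subset.1 hev
    refine ⟨δ₀, hδ₀, fun δ δ' hδ hδlt hδ' hδ'lt => ?_⟩
    have h1 : dist (u δ) L < ε / 2 := hsub ⟨hδ, hδlt⟩
    have h2 : dist (u δ') L < ε / 2 := hsub ⟨hδ', hδ'lt⟩
    calc dist (u δ) (u δ') ≤ dist (u δ) L + dist (u δ') L := dist_triangle_right _ _ _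
      _ < ε / 2 + ε / 2 := add_lt_add h1 h2
      _ = ε := add_halves ε
  · intro h
    rw [← cauchy_map_iff_exists_tendsto]
    refine Metric.cauchy_iff.2 ⟨inferInstance, fun ε hε => ?_⟩
    obtain ⟨δ₀, hδ₀, hδ⟩ := h ε hε
    refine ⟨u '' Set.Ioo 0 δ₀, Filter.image_mem_map (Ioo_mem_nhdsGT hδ₀), ?_⟩
    rintro x ⟨δ, ⟨hδpos, hδlt⟩, rfl⟩ y ⟨δ', ⟨hδ'pos, hδ'lt⟩, rfl⟩
    exact hδ δ δ' hδpos hδlt hδ'pos hδ'lt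

/-- **The Cauchy (two-mesh) form of the crux.**  The critical `δℤ²` SAW laws have a full scaling limit as a
chordal curve family (`LimitExists`, stmt-CriticalPhenomena-1371) IF AND ONLY IF for every Dobrushin domain
`D`, every endpoint approximation `(a, b)`, every bounded continuous observable `f` of the curve class and every
`ε > 0` there is a mesh `δ₀ > 0` below which any two critical expectations differ by less than `ε`:
`|E_δ[f(γ)] - E_δ'[f(γ)]| < ε` for all `δ, δ' ∈ (0, δ₀)`.  (Observable-wise form
`limitExists_iff_forall_tendsto_integral` + Cauchy ⇔ convergent for real nets along `𝓝[>] 0`.) [folklore] -/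
theorem limitExists_iff_forall_cauchy_integral : Summit.CriticalPhenomena.SAWScalingLimit.Theses.SAWRestrictionRigidity.LimitExists ↔ ∀ (D : Literature.Probability.RandomPlanarGeometry.DobrushinDomain) (a b : ℝ → Literature.Probability.LatticeModels.Site 2), Literature.Probability.RandomPlanarGeometry.SAW.IsEndpointApprox D a b → ∀ (f : BoundedContinuousFunction (Literature.Probability.RandomPlanarGeometry.CurveClass ℂ) ℝ) (ε : ℝ), 0 < ε → ∃ δ₀ : ℝ, 0 < δ₀ ∧ ∀ δ δ' : ℝ, 0 < δ → δ < δ₀ → 0 < δ' → δ' < δ₀ → |(∫ γ, f γ.curve ∂(Literature.Probability.RandomPlanarGeometry.SAW.law D.carrier δ (a δ) (b δ))) - ∫ γ, f γ.curve ∂(Literature.Probability.RandomPlanarGeometry.SAW.law D.carrier δ' (a δ') (b δ'))| < ε := by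
  rw [limitExists_iff_forall_tendsto_integral]
  refine forall₄_congr fun D a b _ => forall_congr' fun f => ?_
  rw [exists_tendsto_nhdsGT_iff_forall_dist_lt]
  simp only [Real.dist_eq]

/-- **The Cauchy form modulo tightness, on countably many observables.**  There is ONE countable family `F` of
bounded continuous observables of the curve class, separating finite measures, such that `LimitExists` holds
IF AND ONLY IF the pushed critical SAW laws are eventually tight (`EventualTight`, stmt-CriticalPhenomena-1372) AND
for every Dobrushin domain, endpoint approximation, `f ∈ F` and `ε > 0` some `δ₀ > 0` has
`|E_δ[f(γ)] - E_δ'[f(γ)]| < ε` for all `δ, δ' ∈ (0, δ₀)`: beyond tightness the crux is countably many two-mesh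
comparisons per (domain, approximation).  (Lead c4's `limitExists_iff_eventualTight_and_countable` + Cauchy ⇔
convergent.) [folklore] -/
theorem limitExists_iff_eventualTight_and_countable_cauchy : ∃ F : Set (BoundedContinuousFunction (Literature.Probability.RandomPlanarGeometry.CurveClass ℂ) ℝ), F.Countable ∧ (∀ μ ν : MeasureTheory.Measure (Literature.Probability.RandomPlanarGeometry.CurveClass ℂ), MeasureTheory.IsFiniteMeasure μ → MeasureTheory.IsFiniteMeasure ν → (∀ f ∈ F, ∫ x, f x ∂μ = ∫ x, f x ∂ν) → μ = ν) ∧ (Summit.CriticalPhenomena.SAWScalingLimit.Theses.SAWRestrictionRigidity.LimitExists ↔ (Summit.CriticalPhenomena.SAWScalingLimit.Theses.SAWRestrictionRigidity.EventualTight ∧ ∀ (D : Literature.Probability.RandomPlanarGeometry.DobrushinDomain) (a b : ℝ → Literature.Probability.LatticeModels.Site 2), Literature.Probability.RandomPlanarGeometry.SAW.IsEndpointApprox D a b → ∀ f ∈ F, ∀ ε : ℝ, 0 < ε → ∃ δ₀ : ℝ, 0 < δ₀ ∧ ∀ δ δ' : ℝ, 0 < δ → δ < δ₀ → 0 < δ'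 → δ' < δ₀ → |(∫ γ, f γ.curve ∂(Literature.Probability.RandomPlanarGeometry.SAW.law D.carrier δ (a δ) (b δ))) - ∫ γ, f γ.curve ∂(Literature.Probability.RandomPlanarGeometry.SAW.law D.carrier δ' (a δ') (b δ'))| < ε)) := by
  obtain ⟨F, hFc, hFsep, hiff⟩ := limitExists_iff_eventualTight_and_countable
  refine ⟨F, hFc, hFsep, hiff.trans (and_congr_right fun _ => ?_)⟩
  refine forall₄_congr fun D a b _ => forall₂_congr fun f _ => ?_
  rw [exists_tendsto_nhdsGT_iff_forall_dist_lt]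
  simp only [Real.dist_eq]

end Summit.CriticalPhenomena.SAWScalingLimit.Theorems.SAWRestrictionRigidityLimitExists

end
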